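import Summits.Parity.GeneralizedHardyLittlewood.Theorems.LiouvilleShiftedTablesTypeI2DilatedURB6
import Summits.Parity.GeneralizedHardyLittlewood.Theorems.LiouvilleShiftedTablesTypeI2DilatedURB8
import Summits.Parity.GeneralizedHardyLittlewood.Theorems.LiouvilleShiftedTablesTypeI2DilatedURB10
import Summits.Parity.GeneralizedHardyLittlewood.Theorems.LiouvilleShiftedTablesTypeI2DilatedURB11

/-!
# The `𝔲_R` terms of the assembly: Type I, and the registered stub `stub_uRBound : URBound`

Route `LiouvilleShiftedTables` (Parity / GeneralizedHardyLittlewood), crux `TypeI2Dilated` (stmt-Parity-14272), line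
`peel-to-drappeau`.  This file proves the registered stub `stub_uRBound : URBound` of the line's skeleton from the chain
`…TypeI2DilatedURB1`–`…URB8`, `…URB10`, `…URB11` (imports `…URB6`, `…URB8`, `…URB10`, `…URB11`).

**Type I** (`urb_typeI`).  Let `F_{j,κ}` (`1 ≤ j ≤ 4`) be a box piece and `T` a set of `1 ≤ #T ≤ 3` slots, all of them
`ζ`-slots (`j < i`) with scales `V_i > x^{1/3−1/50}`, while the other slots have `∏_{i ∉ T} V_i ≤ x^{1/50}`.  Then
`NS(F_{j,κ}) ≤ x^{1−6ρ}` for `0 < ρ ≤ ρ₃(c)` and `x ≥ x₀(ρ)`, given the hypothesis `DilatedDivisorAP` (Fouvry–Tenenbaum's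
Lemmas 4.12/4.13, which yield `DivisorAPTuple k (1/2 + 1/85)` for `k = 0, 1, 2`, `divisorAPTuple_of_dilated`):
by `normSum_hbBox_typeI_le` (`…URB6`) and `typeI_B_le` (`…URB8`, for the three values of `k` at once:
`typeI_B_le_all`), `NS(F) ≤ ∑_{q,r} ∑_{ν ≤ 2^8x^{1/50}} |A(ν)| x^{1−12ρ}/ν ≤ x^{5ρ} x^{1−12ρ} ∑_ν τ(ν)^8/ν ≤ x^{1−6ρ}`.

**`URBound`** (`stub_uRBound`): assuming `DilatedTypeII` (Drappeau's Theorem 5.1 in crux coordinates) and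
`DilatedDivisorAP`, for `c ≠ 0` there is `ρ₁ > 0` such that for `0 < ρ ≤ ρ₁`, `x ≥ x₀`, every class `w`, height
`Y ≤ 2x`, smooth-part index `P ≥ 1` with `P R ≤ x^{4ρ}` and every dyadic block of smooth moduli with `x^{1/2−9ρ} ≤ Slo`,
`2 Slo R P ≤ x^{1/2+ρ}`:
`∑_{q ≤ x^ρ} ∑_{r ≤ R} ‖∑_{s ∈ sRange c q (rP) Slo (2Slo)} uRPiece c q w (rP) s Y (x^{40ρ})‖ ≤ C x^{1−5ρ}`.
Proof: the left side is `NS(λ)` (`lhs_eq_normSum`); if `R < 1` or `Y < 0` it vanishes; otherwise Step D (`urb_decomp`,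
`…URB11`) bounds it by `6 ∑_{j ≤ 4} ∑_κ NS(F_{j,κ}) + NS(1_{□,>K} ⋆ μ)`, every box piece has `NS(F_{j,κ}) ≤ x^{1−6ρ}`
(`urb_box`, `…URB10`: Types 0 / II / I, the Type I input being `urb_typeI` of this file), the tail has `NS ≤ x^{1−6ρ}`
(`urb_tail`, `…URB2`), and there are `K_b^{2j}` tuples `κ` with `6 ∑_j K_b^{2j} + 1 ≤ x^ρ` (`urb_numerics`); so
`NS(λ) ≤ x^ρ · x^{1−6ρ} = x^{1−5ρ}` (`C = 1`).
[this line: Lines/peel-to-drappeau.md; cite: Drappeau2017, §6; FouvryTenenbaum2021, Lemmas 4.12–4.13; Heathbrown1982]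
-/

noncomputable section

namespace Summit.Parity.GeneralizedHardyLittlewood.Cruxes.TypeI2Dilated.PeelToDrappeau

open Finset Fintype Real Filter
open scoped ArithmeticFunction.sigma Classical
open Literature.NumberTheory.Sieve Literature.NumberTheory.Sieve.Drappeau2017
  Literature.NumberTheory.Sieve.FouvryTenenbaum2021

/-- The divisor-function input for `k = 0, 1, 2` initial variables at level `1/2 + 1/85`, from `DilatedDivisorAP`
(`k = 0` is unconditional). [cite: FouvryTenenbaum2021, Lemmas 4.12–4.13] -/
theorem divisorAPTuple_of_dilated (hFT : DilatedDivisorAP) {k : ℕ} (hk : k ≤ 2) :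
    DivisorAPTuple k (1 / 2 + 1 / 85) := by
  interval_cases k
  · exact divisorAPTuple_zero (by norm_num)
  · exact divisorAPTuple_mono (divisorAPTuple_one hFT.1) (by norm_num)
  · exact divisorAPTuple_two hFT.2

/-- `typeI_B_le` for the three values `k = 0, 1, 2` with one exponent `ρ₂`. [this line] -/
theorem typeI_B_le_all (hFT : DilatedDivisorAP) (c : ℤ) :
    ∃ ρ₂ : ℝ, 0 < ρ₂ ∧ ∀ k : ℕ, k ≤ 2 → ∀ ρ : ℝ, 0 < ρ → ρ ≤ ρ₂ → ∃ x₀ : ℝ, ∀ x : ℝ, x₀ ≤ x →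
      ∀ w : ℕ, ∀ Y R Slo : ℝ, ∀ P : ℕ, 1 ≤ P → 0 ≤ Y → Y ≤ 2 * x → 1 ≤ R → (P : ℝ) * R ≤ x ^ (4 * ρ) →
        0 ≤ Slo → 2 * Slo * R * P ≤ x ^ (1 / 2 + ρ) →
      ∀ q ∈ Icc 1 ⌊x ^ ρ⌋₊, ∀ r ∈ Icc 1 ⌊R⌋₊, ∀ W : Fin (k + 1) → ℝ, (∀ t, x ^ (1 / 3 - 1 / 50 : ℝ) < W t) →
      ∀ ν ∈ Icc 1 ⌊(2 : ℝ) ^ 8 * x ^ (1 / 50 : ℝ)⌋₊,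
        ∑ s ∈ sRange c q (r * P) Slo (2 * Slo), ‖∑ n ∈ piFinset (fun t => BFI.dyadic (W t)),
          (if ν * ∏ t, n t ∈ classFilter c q w (r * P) Y then
            uR (x ^ (40 * ρ)) s (((ν * ∏ t, n t : ℕ) : ZMod s) * ((c : ZMod s))⁻¹) else 0)‖ ≤
          x ^ (1 - 12 * ρ) / ν := by
  obtain ⟨ρa, hρa, ha⟩ := typeI_B_le (k := 0) (by norm_num) (divisorAPTuple_of_dilated hFT (by norm_num)) c
  obtain ⟨ρb, hρb, hb⟩ := typeI_B_le (k := 1) (by norm_num) (divisorAPTuple_of_dilated hFT (by norm_num)) c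
  obtain ⟨ρd, hρd, hd⟩ := typeI_B_le (k := 2) (by norm_num) (divisorAPTuple_of_dilated hFT (by norm_num)) c
  refine ⟨min ρa (min ρb ρd), lt_min hρa (lt_min hρb hρd), fun k hk ρ hρ hρle => ?_⟩
  interval_cases k
  · exact ha ρ hρ (hρle.trans (min_le_left _ _))
  · exact hb ρ hρ (hρle.trans ((min_le_right _ _).trans (min_le_left _ _)))
  · exact hd ρ hρ (hρle.trans ((min_le_right _ _).trans (min_le_right _ _)))

/-- `∑_{ν ≤ N} τ(ν)^8/ν ≤ C (log N)^{512}` for `N ≥ 2`. [folklore] -/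
theorem exists_sum_sigma_pow_eight_div_le :
    ∃ C : ℝ, 0 < C ∧ ∀ N : ℝ, 2 ≤ N → ∑ ν ∈ Icc 1 ⌊N⌋₊, (σ 0 ν : ℝ) ^ 8 / ν ≤ C * Real.log N ^ 512 := by
  obtain ⟨C, hC, h⟩ := exists_sum_sigma_zero_pow_div_le_real 8
  exact ⟨C, hC, fun N hN => by simpa using h N hN⟩

set_option maxHeartbeats 800000 in
/-- **Type I, given the bound for `B(q, r, ν)`**: if `B(q, r, ν) ≤ x^{1−12ρ}/ν` for the scales of the large slots `T`
(`#T = k + 1`, `ζ`-slots) and all `1 ≤ ν ≤ 2^8 x^{1/50}`, and `∏_{i ∉ T} V_i ≤ x^{1/50}`, then `NS(F_{j,κ}) ≤ x^{1−6ρ}`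
(for `x` large in terms of `ρ` and the divisor-moment constant `C₈`; a long bookkeeping proof, hence the raised
heartbeat limit). [this line] -/
theorem normSum_typeI_of_B {C₈ : ℝ} (hC₈ : 0 ≤ C₈)
    (h8 : ∀ N : ℝ, 2 ≤ N → ∑ ν ∈ Icc 1 ⌊N⌋₊, (σ 0 ν : ℝ) ^ 8 / ν ≤ C₈ * Real.log N ^ 512)
    {x ρ : ℝ} (hx2 : 2 ≤ x) (e1 : C₈ * Real.log x ^ 512 ≤ x ^ ρ) (e2 : (2 : ℝ) ^ 8 ≤ x ^ (1 / 100 : ℝ))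
    (c : ℤ) (w P : ℕ) (Y R Slo : ℝ) (hP : 1 ≤ P) (hR : 1 ≤ R) (hPR : (P : ℝ) * R ≤ x ^ (4 * ρ))
    {j : ℕ} (hj : j ≤ 4) (κ : Fin (2 * j) → ℕ) (T : Finset (Fin (2 * j))) {k : ℕ} (hTk : T.card = k + 1)
    (hTζ : ∀ i ∈ T, j < (i : ℕ)) (hTsm : (∏ i ∈ Tᶜ, boxScale x (κ i)) ≤ x ^ (1 / 50 : ℝ))
    (hBk : ∀ q ∈ Icc 1 ⌊x ^ ρ⌋₊, ∀ r ∈ Icc 1 ⌊R⌋₊, ∀ ν ∈ Icc 1 ⌊(2 : ℝ) ^ 8 * x ^ (1 / 50 : ℝ)⌋₊,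
      ∑ s ∈ sRange c q (r * P) Slo (2 * Slo),
        ‖∑ n ∈ piFinset (fun t : Fin (k + 1) => BFI.dyadic (boxScale x (κ (T.orderEmbOfFin hTk t)))),
          (if ν * ∏ t, n t ∈ classFilter c q w (r * P) Y then
            uR (x ^ (40 * ρ)) s (((ν * ∏ t, n t : ℕ) : ZMod s) * ((c : ZMod s))⁻¹) else 0)‖ ≤
        x ^ (1 - 12 * ρ) / ν) :
    normSum c w P x ρ Y R Slo (fun m => hbBox x ρ j κ m) ≤ x ^ (1 - 6 * ρ) := by
  have hx1 : 1 ≤ x := by linarith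
  have hx0 : 0 < x := by linarith
  have hmul : ∀ a b : ℝ, x ^ a * x ^ b = x ^ (a + b) := fun a b => (Real.rpow_add hx0 a b).symm
  have hxpos : ∀ a : ℝ, 0 < x ^ a := fun a => Real.rpow_pos_of_pos hx0 a
  have hx50 : 1 ≤ x ^ (1 / 50 : ℝ) := Real.one_le_rpow hx1 (by norm_num)
  have hNA2 : 2 ≤ (2 : ℝ) ^ 8 * x ^ (1 / 50 : ℝ) := by nlinarith
  have hNAx : (2 : ℝ) ^ 8 * x ^ (1 / 50 : ℝ) ≤ x := by
    calc (2 : ℝ) ^ 8 * x ^ (1 / 50 : ℝ) ≤ x ^ (1 / 100 : ℝ) * x ^ (1 / 50 : ℝ) :=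
          mul_le_mul_of_nonneg_right e2 (hxpos _).le
      _ = x ^ (3 / 100 : ℝ) := by rw [hmul]; norm_num
      _ ≤ x ^ (1 : ℝ) := Real.rpow_le_rpow_of_exponent_le hx1 (by norm_num)
      _ = x := Real.rpow_one x
  have hcardc : Tᶜ.card ≤ 8 := by rw [Finset.card_compl, Fintype.card_fin]; omega
  have hNAprod : ∏ i ∈ Tᶜ, (2 * boxScale x (κ i)) ≤ (2 : ℝ) ^ 8 * x ^ (1 / 50 : ℝ) := by
    rw [prod_two_mul]
    exact mul_le_mul (pow_le_pow_right₀ (by norm_num) hcardc) hTsm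
      (Finset.prod_nonneg fun i _ => (boxScale_pos hx0 _).le) (by positivity)
  refine (normSum_hbBox_typeI_le hx0 ρ κ T hTk hTζ (by linarith) hNAprod c w P Y R Slo).trans ?_
  have hAle : ∀ ν, |(∏ i ∈ Tᶜ, hbSlot x ρ j κ i) ν| ≤ (σ 0 ν : ℝ) ^ 8 := fun ν =>
    abs_prod_hbSlot_le_pow_eight x ρ κ hcardc ν
  have hR0 : 0 ≤ R := by linarith
  have hfloor := floor_mul_floor_le (ρ := ρ) hx0 hR0 (le_trans (le_mul_of_one_le_left hR0 (by exact_mod_cast hP)) hPR)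
  -- the `ν`-sum
  have hSνle : ∑ ν ∈ Icc 1 ⌊(2 : ℝ) ^ 8 * x ^ (1 / 50 : ℝ)⌋₊, (σ 0 ν : ℝ) ^ 8 / ν ≤ x ^ ρ := by
    calc _ ≤ C₈ * Real.log ((2 : ℝ) ^ 8 * x ^ (1 / 50 : ℝ)) ^ 512 := h8 _ hNA2
      _ ≤ C₈ * Real.log x ^ 512 := by
          have hlog : Real.log ((2 : ℝ) ^ 8 * x ^ (1 / 50 : ℝ)) ≤ Real.log x := Real.log_le_log (by linarith) hNAx
          have hlog0 : 0 ≤ Real.log ((2 : ℝ) ^ 8 * x ^ (1 / 50 : ℝ)) := Real.log_nonneg (by linarith)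
          gcongr
      _ ≤ x ^ ρ := e1
  have hS0 : 0 ≤ ∑ ν ∈ Icc 1 ⌊(2 : ℝ) ^ 8 * x ^ (1 / 50 : ℝ)⌋₊, (σ 0 ν : ℝ) ^ 8 / ν :=
    Finset.sum_nonneg fun ν _ => div_nonneg (pow_nonneg (Nat.cast_nonneg _) _) (Nat.cast_nonneg _)
  have hinner : ∀ q ∈ Icc 1 ⌊x ^ ρ⌋₊, ∀ r ∈ Icc 1 ⌊R⌋₊,
      ∑ ν ∈ Icc 1 ⌊(2 : ℝ) ^ 8 * x ^ (1 / 50 : ℝ)⌋₊, |(∏ i ∈ Tᶜ, hbSlot x ρ j κ i) ν| *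
        ∑ s ∈ sRange c q (r * P) Slo (2 * Slo),
          ‖∑ n ∈ piFinset (fun t : Fin (k + 1) => BFI.dyadic (boxScale x (κ (T.orderEmbOfFin hTk t)))),
            (if ν * ∏ t, n t ∈ classFilter c q w (r * P) Y then
              uR (x ^ (40 * ρ)) s (((ν * ∏ t, n t : ℕ) : ZMod s) * ((c : ZMod s))⁻¹) else 0)‖ ≤
      x ^ (1 - 12 * ρ) * ∑ ν ∈ Icc 1 ⌊(2 : ℝ) ^ 8 * x ^ (1 / 50 : ℝ)⌋₊, (σ 0 ν : ℝ) ^ 8 / ν := by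
    intro q hq r hr
    rw [Finset.mul_sum]
    refine Finset.sum_le_sum fun ν hν => ?_
    have hν0 : (0 : ℝ) < ν := by exact_mod_cast (Finset.mem_Icc.1 hν).1
    calc _ ≤ (σ 0 ν : ℝ) ^ 8 * (x ^ (1 - 12 * ρ) / ν) :=
          mul_le_mul (hAle ν) (hBk q hq r hr ν hν) (Finset.sum_nonneg fun _ _ => norm_nonneg _)
            (pow_nonneg (Nat.cast_nonneg _) _)
      _ = x ^ (1 - 12 * ρ) * ((σ 0 ν : ℝ) ^ 8 / ν) := by ring
  calc _ ≤ ∑ _q ∈ Icc 1 ⌊x ^ ρ⌋₊, ∑ _r ∈ Icc 1 ⌊R⌋₊,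
        x ^ (1 - 12 * ρ) * ∑ ν ∈ Icc 1 ⌊(2 : ℝ) ^ 8 * x ^ (1 / 50 : ℝ)⌋₊, (σ 0 ν : ℝ) ^ 8 / ν :=
        Finset.sum_le_sum fun q hq => Finset.sum_le_sum fun r hr => hinner q hq r hr
    _ = (⌊x ^ ρ⌋₊ : ℝ) * (⌊R⌋₊ : ℝ) *
        (x ^ (1 - 12 * ρ) * ∑ ν ∈ Icc 1 ⌊(2 : ℝ) ^ 8 * x ^ (1 / 50 : ℝ)⌋₊, (σ 0 ν : ℝ) ^ 8 / ν) := by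
        rw [Finset.sum_const, Finset.sum_const, Nat.card_Icc, Nat.card_Icc, smul_smul, nsmul_eq_mul]
        push_cast; ring
    _ ≤ x ^ (5 * ρ) * (x ^ (1 - 12 * ρ) * x ^ ρ) :=
        mul_le_mul hfloor (mul_le_mul_of_nonneg_left hSνle (hxpos _).le) (mul_nonneg (hxpos _).le hS0) (hxpos _).le
    _ = x ^ (1 - 6 * ρ) := by rw [hmul, hmul]; ring_nf

/-- **Type I.** See the module docstring. [this line; cite: Drappeau2017, §6.2] -/
theorem urb_typeI (hFT : DilatedDivisorAP) (c : ℤ) :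
    ∃ ρ₃ : ℝ, 0 < ρ₃ ∧ ∀ ρ : ℝ, 0 < ρ → ρ ≤ ρ₃ → ∃ x₀ : ℝ, ∀ x : ℝ, x₀ ≤ x →
      ∀ w : ℕ, ∀ Y R Slo : ℝ, ∀ P : ℕ, 1 ≤ P → 0 ≤ Y → Y ≤ 2 * x → 1 ≤ R → (P : ℝ) * R ≤ x ^ (4 * ρ) →
        0 ≤ Slo → 2 * Slo * R * P ≤ x ^ (1 / 2 + ρ) →
      ∀ j ∈ Icc 1 4, ∀ κ : Fin (2 * j) → ℕ, ∀ T : Finset (Fin (2 * j)), 1 ≤ T.card → T.card ≤ 3 →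
        (∀ i ∈ T, j < (i : ℕ)) → (∀ i ∈ T, x ^ (1 / 3 - 1 / 50 : ℝ) < boxScale x (κ i)) →
        (∏ i ∈ Tᶜ, boxScale x (κ i)) ≤ x ^ (1 / 50 : ℝ) →
        normSum c w P x ρ Y R Slo (fun m => hbBox x ρ j κ m) ≤ x ^ (1 - 6 * ρ) := by
  obtain ⟨ρ₂, hρ₂, hB⟩ := typeI_B_le_all hFT c
  obtain ⟨C₈, hC₈, h8⟩ := exists_sum_sigma_pow_eight_div_le
  refine ⟨ρ₂, hρ₂, fun ρ hρ hρle => ?_⟩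
  obtain ⟨xa, hxa⟩ := hB 0 (by norm_num) ρ hρ hρle
  obtain ⟨xb, hxb⟩ := hB 1 (by norm_num) ρ hρ hρle
  obtain ⟨xd, hxd⟩ := hB 2 (by norm_num) ρ hρ hρle
  have hev : ∀ᶠ x : ℝ in atTop, C₈ * Real.log x ^ 512 ≤ x ^ ρ ∧ (2 : ℝ) ^ 8 ≤ x ^ (1 / 100 : ℝ) ∧ (2 : ℝ) ≤ x :=
    (eventually_mul_log_pow_le _ 512 hρ).and ((eventually_le_rpow _ (by norm_num)).and (eventually_ge_atTop _))
  obtain ⟨x₁, hx₁⟩ := Filter.eventually_atTop.1 hev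
  refine ⟨max (max xa xb) (max xd x₁), fun x hx w Y R Slo P hP hY0 hY hR hPR hSlo hSRP j hj κ T hT1 hT3 hTζ hTbig hTsm
    => ?_⟩
  have hxa' : xa ≤ x := le_trans ((le_max_left _ _).trans (le_max_left _ _)) hx
  have hxb' : xb ≤ x := le_trans ((le_max_right _ _).trans (le_max_left _ _)) hx
  have hxd' : xd ≤ x := le_trans ((le_max_left _ _).trans (le_max_right _ _)) hx
  obtain ⟨e1, e2, e3⟩ := hx₁ x (le_trans ((le_max_right _ _).trans (le_max_right _ _)) hx)
  rw [Finset.mem_Icc] at hj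
  -- `k + 1 = #T`
  obtain ⟨k, hTk⟩ : ∃ k, T.card = k + 1 := ⟨T.card - 1, by omega⟩
  have hk : k ≤ 2 := by omega
  have hWt : ∀ t : Fin (k + 1), x ^ (1 / 3 - 1 / 50 : ℝ) < boxScale x (κ (T.orderEmbOfFin hTk t)) := fun t =>
    hTbig _ (Finset.orderEmbOfFin_mem T hTk t)
  refine normSum_typeI_of_B hC₈.le h8 e3 e1 e2 c w P Y R Slo hP hR hPR hj.2 κ T hTk hTζ hTsm fun q hq r hr ν hν => ?_
  interval_cases k
  · exact hxa x hxa' w Y R Slo P hP hY0 hY hR hPR hSlo hSRP q hq r hr _ hWt ν hν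
  · exact hxb x hxb' w Y R Slo P hP hY0 hY hR hPR hSlo hSRP q hq r hr _ hWt ν hν
  · exact hxd x hxd' w Y R Slo P hP hY0 hY hR hPR hSlo hSRP q hq r hr _ hWt ν hν

/-! ### The registered stub -/

/-- **STUB `stub_uRBound` — the `𝔲_R` terms of the assembly** (`URBound`), proved from `DilatedTypeII` and
`DilatedDivisorAP` by Heath-Brown's identity for `λ = 1_□ ⋆ μ` and Drappeau's trichotomy (Types 0 / II / I), see the
module docstring. [this line; cite: Drappeau2017, §6] -/
theorem stub_uRBound : URBound := by
  intro hDT hFT c hc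
  obtain ⟨ρ₁, hρ₁, hρ₁1, hbox⟩ := urb_box hDT hc (urb_typeI hFT c)
  refine ⟨ρ₁, hρ₁, fun ρ hρ hρle => ?_⟩
  have hρ100 : ρ ≤ 1 / 100 := hρle.trans hρ₁1
  obtain ⟨x₁, hx₁⟩ := hbox ρ hρ hρle
  obtain ⟨x₂, hx₂⟩ := urb_tail c hρ hρ100
  obtain ⟨x₃, hx₃1, hx₃⟩ := urb_numerics hρ
  refine ⟨1, max x₁ (max x₂ x₃), fun x hx w Y R Slo P hP hY hPR hSlo hSR => ?_⟩
  have hx1 : x₁ ≤ x := le_trans (le_max_left _ _) hx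
  have hx2 : x₂ ≤ x := le_trans ((le_max_left _ _).trans (le_max_right _ _)) hx
  have hx3 : x₃ ≤ x := le_trans ((le_max_right _ _).trans (le_max_right _ _)) hx
  have hxone : 1 ≤ x := hx₃1.trans hx3
  have hx0 : 0 < x := by linarith
  have hpos : 0 ≤ x ^ (1 - 5 * ρ) := Real.rpow_nonneg hx0.le _
  rw [lhs_eq_normSum, one_mul]
  -- degenerate ranges
  by_cases hR : 1 ≤ R
  swap
  · have hR0 : ⌊R⌋₊ = 0 := Nat.floor_eq_zero.2 (lt_of_not_ge hR)
    unfold normSum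
    rw [hR0, Finset.Icc_eq_empty_of_lt Nat.zero_lt_one]
    simpa using hpos
  by_cases hY0 : 0 ≤ Y
  swap
  · rw [normSum_eq_zero_of c w P x ρ Y R Slo fun m hm => ?_]
    · exact hpos
    · rw [Nat.floor_of_nonpos (le_of_lt (lt_of_not_ge hY0)), Finset.mem_Icc] at hm
      omega
  have hSlo0 : 0 ≤ Slo := (Real.rpow_nonneg hx0.le _).trans hSlo
  -- the main case
  have hB := hx₁ x hx1 w Y R Slo P hP hY0 hY hR hPR hSlo hSR
  have hT := hx₂ x hx2 w Y R Slo P hP hY hR hPR hSlo0 hSR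
  have hN := hx₃ x hx3
  have hD := urb_decomp c w P hx0 ρ hY R Slo
  have hsum : ∑ j ∈ Icc 1 4, ∑ κ ∈ piFinset (fun _ : Fin (2 * j) => Finset.range (urbKb x)),
        normSum c w P x ρ Y R Slo (fun m => hbBox x ρ j κ m) ≤
      ∑ j ∈ Icc 1 4, ((urbKb x : ℝ) ^ (2 * j)) * x ^ (1 - 6 * ρ) := by
    refine Finset.sum_le_sum fun j hj => ?_
    calc ∑ κ ∈ piFinset (fun _ : Fin (2 * j) => Finset.range (urbKb x)),
          normSum c w P x ρ Y R Slo (fun m => hbBox x ρ j κ m)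
        ≤ ∑ _κ ∈ piFinset (fun _ : Fin (2 * j) => Finset.range (urbKb x)), x ^ (1 - 6 * ρ) :=
          Finset.sum_le_sum fun κ _ => hB j hj κ
      _ = ((urbKb x : ℝ) ^ (2 * j)) * x ^ (1 - 6 * ρ) := by
          rw [Finset.sum_const, nsmul_eq_mul, Fintype.card_piFinset_const, Finset.card_range]
          push_cast
          ring
  have hpos6 : 0 ≤ x ^ (1 - 6 * ρ) := Real.rpow_nonneg hx0.le _
  calc normSum c w P x ρ Y R Slo (fun m => (ArithmeticFunction.liouville m : ℝ))
      ≤ 6 * ∑ j ∈ Icc 1 4, ((urbKb x : ℝ) ^ (2 * j)) * x ^ (1 - 6 * ρ) + x ^ (1 - 6 * ρ) :=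
        hD.trans (add_le_add (mul_le_mul_of_nonneg_left hsum (by norm_num)) hT)
    _ = (6 * (∑ j ∈ Icc 1 4, ((urbKb x : ℝ) ^ (2 * j))) + 1) * x ^ (1 - 6 * ρ) := by
        rw [add_mul, mul_assoc, ← Finset.sum_mul, one_mul]
    _ ≤ x ^ ρ * x ^ (1 - 6 * ρ) := mul_le_mul_of_nonneg_right hN hpos6
    _ = x ^ (1 - 5 * ρ) := by rw [← Real.rpow_add hx0]; ring_nf

end Summit.Parity.GeneralizedHardyLittlewood.Cruxes.TypeI2Dilated.PeelToDrappeau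

end
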